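import Literature.IUT.HodgeArakelov.MonoThetaProjectiveLimOneGroups

/-!
# [IUTchII] Prop. 1.5 (i)′ is still a schema, III: the lim¹ twin — a JUNK [IUTchII] §1 setting, model family,
# model reductions, Def. 1.1 (i) outputs, the two projective systems, and the shift isomorphisms (toy)

S. Mochizuki, *Inter-universal Teichmüller theory II*, kurims manuscript (Dec. 2020), §1: the data of p. 20, Def. 1.1 (i)
pp. 20–21, Prop. 1.5 (i)(ii) p. 29 [claim: Mochizuki2012, status: disputed] (IUTchII §1 Prop 1.5, kurims p.29); [EtTh] Def.
2.13 (ii) (morphisms of mono-theta environments).  FACT-LIST row **F-0670** `Prop15_i'`.  abc-iut cell, block F, seat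
abc-iut-f-130 (gen 8).  Sequel of `MonoThetaProjectiveLimOneGroups.lean`; pattern of abc-iut-f-185's `Prop13ToyModel.lean`
(whose plumbing `subSubquotient` / `subCarrierEquiv` is imported BY NAME).

THE TOY (closed, universe `0`): `setting` (`N := 1`, `l := 3`, `p := 5`, `k := ℂ`, `Π^tp := E₀ =: G_k`, `aug := id`);
`family` (`Π_M := E₀ × ℤ/M`, `D := Inn`, theta section portion `:=` the cones `{T̂_m : m ∈ Mon}`); `reductions`
(`red_{M∣M'} := Phom h d 0`, `d = v₂(M') − v₂(M)` — surjective, functorial, carrying `D` to `D` and the cones ONTO the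
cones); `recon M` (Def. 1.1 (i) output: `Π_Y := Π_X := G := E₀`, `(l·Δ_Θ) := Ẑ`, `Π_μ := ℤ/M`, trivial actions);
`sys a` (the projective system with transitions `U^{a·c_d} ∘ red`: `a = 0` is the MODEL system `A`, `a = 1` its TWIN
`B`); the shift `U^k` of `Π_M` as an ISOMORPHISM OF MONO-THETA ENVIRONMENTS of the model (`isoShift`: it fixes
`D = Inn` and permutes the cones), and `isoHom ε`, the underlying homomorphism of any such isomorphism re-bundled over
`Π_M`.  JUNK/TOY by design (no curve, no theta function; `Δ = 1`); an inhabitant decides a universal closure and nothing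
more; no side taken on [IUTchIII] Cor. 3.12; typed ≠ proved.
-/

noncomputable section

namespace Literature.IUT.HodgeArakelov

namespace LimOneToy

open Prop13Toy (Zh subSubquotient subCarrierEquiv)

/-! ## The [IUTchII] §1 interface objects: setting, model family, reductions, Def 1.1 (i) outputs, systems -/

/-- Inner automorphisms of a topological group are bi-continuous (plumbing). [claim: Mochizuki2012, status: disputed] (IUTchII §1 Prop 1.5 (i), kurims p.29) -/
theorem continuous_of_mem_range_conj {G : Type} [Group G] [TopologicalSpace G] [IsTopologicalGroup G]
    (ψ : MulAut G) (hψ : ψ ∈ (MulAut.conj : G →* MulAut G).range) : Continuous ψ ∧ Continuous ψ.symm := by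
  obtain ⟨g, rfl⟩ := hψ
  have h1 : ((MulAut.conj g : MulAut G) : G → G) = fun x => g * x * g⁻¹ :=
    funext fun x => MulAut.conj_apply g x
  have h2 : ((MulAut.conj g : MulAut G).symm : G → G) = fun x => g⁻¹ * x * g⁻¹⁻¹ := by
    funext x
    rw [← MulAut.inv_def, ← map_inv, MulAut.conj_apply]
  refine ⟨?_, ?_⟩
  · rw [h1]; exact (continuous_const.mul continuous_id).mul continuous_const
  · rw [h2]; exact (continuous_const.mul continuous_id).mul continuous_const

/-- The kernel of `E₀ × ℤ/M ↠ E₀` is `ℤ/M`. [claim: Mochizuki2012, status: disputed] (IUTchII §1 Prop 1.5 (i), kurims p.29) -/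
def kerFstEquiv (M : ℕ+) : (MonoidHom.fst E₀ (Multiplicative (ZMod M))).ker ≃* Multiplicative (ZMod M) where
  toFun x := (x : Car M).2
  invFun z := ⟨(1, z), by rw [MonoidHom.mem_ker]; rfl⟩
  left_inv x := Subtype.ext (Prod.ext ((MonoidHom.mem_ker).mp x.2).symm rfl)
  right_inv _ := rfl
  map_mul' _ _ := rfl

/-- The JUNK [IUTchII] §1 setting of the lim¹ toy: `N := 1`, `l := 3`, `p := 5`, `k := ℂ`, `Π^tp := E₀ =: G_k`
with `aug := id`. [claim: Mochizuki2012, status: disputed] (IUTchII §1 Prop 1.5 (i), kurims p.29) -/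
@[reducible] def setting : ThetaSetting.{0} where
  N := 1
  l := 3
  l_prime := Nat.prime_three
  l_odd := by decide
  p := 5
  p_prime := Nat.prime_five
  p_odd := by decide
  p_ne_l := by decide
  k := ℂ
  hasPrimitiveRoot := ⟨Complex.exp (2 * Real.pi * Complex.I / (4 * 3 : ℕ)),
    Complex.isPrimitiveRoot_exp (4 * 3) (by decide)⟩
  PiX := TopGroup.of E₀
  Gk := TopGroup.of E₀
  aug := MonoidHom.id E₀
  aug_continuous := continuous_id
  aug_surjective := Function.surjective_id
  modelPi := TopGroup.of E₀
  modelD := (MulAut.conj : E₀ →* MulAut E₀).range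
  modelD_inn := le_rfl
  modelD_continuous := fun ψ hψ => continuous_of_mem_range_conj ψ hψ
  modelTheta := ∅

/-- The JUNK model family: `Π_M := E₀ × ℤ/M`, `D := Inn`, theta section portion `:=` the cones `{T̂_m : m ∈ Mon}`. [claim: Mochizuki2012, status: disputed] (IUTchII §1 Prop 1.5 (i), kurims p.29) -/
@[reducible] def family : ModelFamily setting where
  modelPi M := TopGroup.of (Car M)
  modelD M := (MulAut.conj : Car M →* MulAut (Car M)).range
  modelD_inn _ := le_rfl
  modelD_continuous _ := fun ψ hψ => continuous_of_mem_range_conj ψ hψ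
  modelTheta M := Set.range (coneHat M)

/-- The JUNK model reductions: `red_{M∣M'} := (mapDomain φ^{v₂(M')−v₂(M)}) × id_Ẑ × (ℤ/M' ↠ ℤ/M)`. [claim: Mochizuki2012, status: disputed] (IUTchII §1 Prop 1.5 (i), kurims p.29) -/
@[reducible] def reductions : family.Reductions where
  red h := transOf 0 h
  red_continuous h := continuous_Phom h _ _
  red_surjective h := Phom_surjective h _ _
  red_refl M y := transOf_refl 0 M y
  red_comp h h' y := transOf_comp 0 h h' y
  red_D h := by
    rintro _ ⟨g, rfl⟩
    refine ⟨MulAut.conj (transOf 0 h g), ⟨_, rfl⟩, fun y => ?_⟩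
    simp only [MulAut.conj_apply, map_mul, map_inv]
  red_theta h := image_map_range_coneHat h _ _

/-- The Def 1.1 (i) output over the model at level `M`: `Π_Y := Π_X := G := E₀` (first projection, identities),
interior cyclotome `Ẑ ⊆ E₀` (as `Ẑ/1`), exterior cyclotome `Ker(E₀ × ℤ/M ↠ E₀) ≅ ℤ/M`, trivial actions. [claim: Mochizuki2012, status: disputed] (IUTchII §1 Prop 1.5 (i), kurims p.29) -/
@[reducible] def recon (M : ℕ+) : Reconstruction (family.modelEnv M) where
  PiY := TopGroup.of E₀
  projY := MonoidHom.fst E₀ (Multiplicative (ZMod M))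
  projY_continuous := continuous_fst
  projY_surjective := Prod.fst_surjective
  projY_quotientMap := isOpenMap_fst.isQuotientMap continuous_fst Prod.fst_surjective
  isClosed_ker_projY := by rw [MonoidHom.coe_ker]; exact isClosed_singleton.preimage continuous_fst
  PiX := TopGroup.of E₀
  inclY := MonoidHom.id E₀
  inclY_isOpenEmbedding := Topology.IsOpenEmbedding.id
  inclY_normal := ⟨fun n _ g => ⟨g * n * g⁻¹, rfl⟩⟩
  G := TopGroup.of E₀
  projG := MonoidHom.id E₀
  projG_continuous := continuous_id
  projG_surjective := Function.surjective_id
  projG_quotientMap := Topology.IsQuotientMap.id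
  isClosed_ker_projG := by rw [MonoidHom.coe_ker]; exact isClosed_singleton.preimage continuous_id
  projG_corresponds := ⟨ContinuousMulEquiv.refl E₀, by
    rw [MonoidHom.ker_id, Subgroup.map_bot]
    exact (MonoidHom.ker_id (G := E₀)).symm⟩
  intCyc := subSubquotient (MonoidHom.inr Rgrp Zh).range
  intAct := 1
  int_iso_ZHat := ⟨(subCarrierEquiv _).trans
    (MonoidHom.ofInjective (f := MonoidHom.inr Rgrp Zh) (fun a b hab => (Prod.mk.inj hab).2)).symm⟩
  extAct := 1
  ext_iso_ZMod := ⟨kerFstEquiv M⟩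
  projG_inclY_surjective := Function.surjective_id
  outer_action_lifts := fun x => ⟨1, fun δ => by
    have hδ : δ.val.1 = 1 := (MonoidHom.mem_ker).mp δ.2
    show δ.val.1 = x * δ.val.1 * x⁻¹
    rw [hδ, mul_one, mul_inv_cancel]⟩

/-- The projective system with twist parameter `a`: transitions `U^{a·c_d} ∘ red` (`a = 0`: the model system
`A`; `a = 1`: its lim¹-twin `B`). [claim: Mochizuki2012, status: disputed] (IUTchII §1 Prop 1.5 (i), kurims p.29) -/
@[reducible] def sys (a : ℤ) : MonoThetaProjSystem family where
  env M := family.modelEnv M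
  recon M := recon M
  trans h := transOf a h
  trans_continuous h := continuous_Phom h _ _
  trans_refl M y := transOf_refl a M y
  trans_comp h h' y := transOf_comp a h h' y
  transX h := Xhom (gap h) (a * cexp (gap h))
  transX_continuous _ := (continuous_of_discreteTopology (f := Rhom _ _)).prodMap continuous_id
  transX_compat _ _ := rfl


/-! ## The shift automorphisms `U^k` as isomorphisms of mono-theta environments -/

/-- Translation by `x^k` on monomials, as a permutation. [claim: Mochizuki2012, status: disputed] (IUTchII §1 Prop 1.5 (i), kurims p.29) -/
def addXEquiv (k : ℤ) : Mon ≃ Mon where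
  toFun := addX k
  invFun := addX (-k)
  left_inv m := by rw [addX_addX, add_neg_cancel, addX_zero, id]
  right_inv m := by rw [addX_addX, neg_add_cancel, addX_zero, id]

/-- `U^k` on `R`: relabelling the monomials by `x^k`. [claim: Mochizuki2012, status: disputed] (IUTchII §1 Prop 1.5 (i), kurims p.29) -/
def shiftR (k : ℤ) : Rgrp ≃* Rgrp := AddEquiv.toMultiplicative (Finsupp.domCongr (addXEquiv k))

/-- `U^k` on `R` is `Rhom 0 k`. [claim: Mochizuki2012, status: disputed] (IUTchII §1 Prop 1.5 (i), kurims p.29) -/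
theorem shiftR_apply (k : ℤ) (r : Rgrp) : shiftR k r = Rhom 0 k r := by
  show Multiplicative.ofAdd (Finsupp.equivMapDomain (addXEquiv k) (Multiplicative.toAdd r)) =
    Multiplicative.ofAdd (Finsupp.mapDomain (gmap 0 k) (Multiplicative.toAdd r))
  rw [Finsupp.equivMapDomain_eq_mapDomain]
  rfl

/-- `U^k` on `Π_M = (R × Ẑ) × ℤ/M`. [claim: Mochizuki2012, status: disputed] (IUTchII §1 Prop 1.5 (i), kurims p.29) -/
def shiftCar (M : ℕ+) (k : ℤ) : Car M ≃* Car M :=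
  ((shiftR k).prodCongr (MulEquiv.refl Zh)).prodCongr (MulEquiv.refl _)

/-- `U^k` on `Π_M` is `Phom (refl) 0 k`. [claim: Mochizuki2012, status: disputed] (IUTchII §1 Prop 1.5 (i), kurims p.29) -/
theorem shiftCar_apply (M : ℕ+) (k : ℤ) (y : Car M) : shiftCar M k y = Phom (dvd_refl (M : ℕ)) 0 k y := by
  rw [Phom_apply, castMul_refl]
  show ((shiftR k y.1.1, y.1.2), y.2) = _
  rw [shiftR_apply]
  rfl

/-- `U^k` on `Π_M` as a homomorphism is `Phom (refl) 0 k`. [claim: Mochizuki2012, status: disputed] (IUTchII §1 Prop 1.5 (i), kurims p.29) -/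
theorem toMonoidHom_shiftCar (M : ℕ+) (k : ℤ) : (shiftCar M k).toMonoidHom = Phom (dvd_refl (M : ℕ)) 0 k :=
  MonoidHom.ext (shiftCar_apply M k)

/-- The inverse of `U^k` is `U^{−k}`. [claim: Mochizuki2012, status: disputed] (IUTchII §1 Prop 1.5 (i), kurims p.29) -/
theorem shiftCar_symm_apply (M : ℕ+) (k : ℤ) (y : Car M) :
    (shiftCar M k).symm y = Phom (dvd_refl (M : ℕ)) 0 (-k) y := by
  apply (shiftCar M k).injective
  rw [MulEquiv.apply_symm_apply, shiftCar_apply, ← MonoidHom.comp_apply, Phom_comp]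
  simp only [pow_zero, one_mul, add_neg_cancel, add_zero]
  exact (Phom_refl_zero_zero M y).symm

/-- `U^k` on `Π_M`, as a bi-continuous automorphism. [claim: Mochizuki2012, status: disputed] (IUTchII §1 Prop 1.5 (i), kurims p.29) -/
def shiftCarC (M : ℕ+) (k : ℤ) : Car M ≃ₜ* Car M :=
  { shiftCar M k with
    continuous_toFun := by
      show Continuous (shiftCar M k)
      rw [show (shiftCar M k : Car M → Car M) = Phom (dvd_refl (M : ℕ)) 0 k from funext (shiftCar_apply M k)]
      exact continuous_Phom _ _ _
    continuous_invFun := by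
      show Continuous (shiftCar M k).symm
      rw [show ((shiftCar M k).symm : Car M → Car M) = Phom (dvd_refl (M : ℕ)) 0 (-k) from
        funext (shiftCar_symm_apply M k)]
      exact continuous_Phom _ _ _ }

/-- `Inn(Π)` is carried to itself by transport along ANY automorphism of `Π`. [claim: Mochizuki2012, status: disputed] (IUTchII §1 Prop 1.5 (i), kurims p.29) -/
theorem map_congr_range_conj {G : Type} [Group G] (e : G ≃* G) :
    (MulAut.conj : G →* MulAut G).range.map (MulAut.congr e).toMonoidHom = (MulAut.conj : G →* MulAut G).range := by
  have key : ∀ g : G, (MulAut.congr e).toMonoidHom (MulAut.conj g) = MulAut.conj (e g) := by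
    intro g
    ext x
    show e (g * e.symm x * g⁻¹) = e g * x * (e g)⁻¹
    rw [map_mul, map_mul, map_inv, MulEquiv.apply_symm_apply]
  ext ψ
  constructor
  · rintro ⟨_, ⟨g, rfl⟩, rfl⟩
    exact ⟨e g, (key g).symm⟩
  · rintro ⟨g, rfl⟩
    refine ⟨MulAut.conj (e.symm g), ⟨_, rfl⟩, ?_⟩
    rw [key, MulEquiv.apply_symm_apply]

/-- `U^k` IS an isomorphism of mono-theta environments of the model at level `M` (it fixes `D = Inn` and
permutes the cones). [claim: Mochizuki2012, status: disputed] (IUTchII §1 Prop 1.5 (i), kurims p.29) -/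
def isoShift (M : ℕ+) (k : ℤ) : MonoThetaEnv.Iso (family.modelEnv M) (family.modelEnv M) where
  iso := shiftCarC M k
  map_D := map_congr_range_conj (shiftCar M k)
  map_theta := by
    show (fun H : Subgroup (Car M) => H.map (shiftCar M k).toMonoidHom) '' Set.range (coneHat M) =
      Set.range (coneHat M)
    rw [toMonoidHom_shiftCar]
    exact image_map_range_coneHat _ _ _

/-- The underlying map of `isoShift M k` is `Phom (refl) 0 k`. [claim: Mochizuki2012, status: disputed] (IUTchII §1 Def 1.1, kurims p.20) -/
theorem isoShift_apply (M : ℕ+) (k : ℤ) (y : Car M) : (isoShift M k).iso y = Phom (dvd_refl (M : ℕ)) 0 k y :=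
  shiftCar_apply M k y

/-- The underlying homomorphism of an isomorphism of mono-theta environments of the model, re-bundled over `Π_M`. [claim: Mochizuki2012, status: disputed] (IUTchII §1 Prop 1.5 (i), kurims p.29) -/
def isoHom {M : ℕ+} (ε : MonoThetaEnv.Iso (family.modelEnv M) (family.modelEnv M)) : Car M →* Car M where
  toFun y := ε.iso y
  map_one' := map_one ε.iso
  map_mul' a b := map_mul ε.iso a b

/-- `isoHom ε` is injective. [claim: Mochizuki2012, status: disputed] (IUTchII §1 Prop 1.5 (i), kurims p.29) -/
theorem isoHom_injective {M : ℕ+} (ε : MonoThetaEnv.Iso (family.modelEnv M) (family.modelEnv M)) :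
    Function.Injective (isoHom ε) := ε.iso.injective

/-- `isoHom ε` permutes the cones `{T̂_m}` (this IS `ε.map_theta`). [claim: Mochizuki2012, status: disputed] (IUTchII §1 Def 1.1, kurims p.20) -/
theorem image_map_isoHom {M : ℕ+} (ε : MonoThetaEnv.Iso (family.modelEnv M) (family.modelEnv M)) :
    (fun H : Subgroup (Car M) => H.map (isoHom ε)) '' Set.range (coneHat M) = Set.range (coneHat M) :=
  ε.map_theta

/-- The chain of indices `2^k`. [claim: Mochizuki2012, status: disputed] (IUTchII §1 Prop 1.5 (i), kurims p.29) -/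
def twoPow (k : ℕ) : ℕ+ := ⟨2 ^ k, pow_pos two_pos k⟩

/-- `2^k ∣ 2^{k+1}`. [claim: Mochizuki2012, status: disputed] (IUTchII §1 Prop 1.5 (i), kurims p.29) -/
theorem twoPow_dvd (k : ℕ) : ((twoPow k : ℕ+) : ℕ) ∣ ((twoPow (k + 1) : ℕ+) : ℕ) :=
  ⟨2, pow_succ 2 k⟩

/-- `v₂(2^k) = k`. [claim: Mochizuki2012, status: disputed] (IUTchII §1 Prop 1.5 (i), kurims p.29) -/
theorem lvl_twoPow (k : ℕ) : lvl (twoPow k) = k := by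
  show (2 ^ k).factorization 2 = k
  rw [Nat.Prime.factorization_pow Nat.prime_two, Finsupp.single_eq_same]

/-- The arrow `2^k ∣ 2^{k+1}` has gap `1`. [claim: Mochizuki2012, status: disputed] (IUTchII §1 Prop 1.5 (i), kurims p.29) -/
theorem gap_twoPow (k : ℕ) : gap (twoPow_dvd k) = 1 := by
  rw [gap, lvl_twoPow, lvl_twoPow]; omega

end LimOneToy

end Literature.IUT.HodgeArakelov

end
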